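import Summits.KontsevichZagierPeriods.KontsevichZagierPeriods.Theorems.SymplecticScissorsRealOnePeriodRelationsStubRatCells
import HarnessLib

/-!
# `RealOnePeriodRelations` (stmt-KontsevichZagierPeriods-10042), line `nash-retraction-thin-strip`,
# reshape 9: the stub `stub_algRatCells` — cells of the algebraic-rational layer

`ConicLayer.stub_algRatCells`: every element of the subgroup of `KZ.FormalRep` generated by

* Kontsevich–Zagier's literal rational representations in dimension one
  (`KZ.IntegralRep.IsRational`: integrand a quotient of polynomials with RATIONAL coefficients on a
  `ℚ`-semialgebraic domain), and
* representations on an interval `{z | z 0 ∈ (a, b)}` with real ALGEBRAIC end points `a < b` whose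
  integrand is on `(a, b)` a quotient `P/Q` of polynomials with real algebraic coefficients
  (`P, Q ∈ (ℚ̄ ∩ ℝ)[X]`, `Q ≠ 0` on `(a, b)`),

is, modulo `M₁ = closure (1a ∪ 1b ∪ 2 ∪ Green)`, a `ℤ`-combination of UNIT cells of the second shape
on `(0, 1)`.  This is the generalisation of the landed rational layer `RationalLayer.stub_ratCells`
and is proved with its machinery: the set of such combinations is the additive subgroup
`RatCells.cellSpanRat ≥ M₁`, so by `AddSubgroup.closure_le` it suffices to place the generators in
it — the literal rational ones by `RatCells.of_mem_cellSpanRat` (`RatCells.ratFns_of_isRational`),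
the algebraic cells by the affine rule-2 move `x = a + (b − a)t` with algebraic coefficients,
`RatCells.of_mem_cellSpanRat_Ioo` (the hypothesis on the integrand is literally membership in
`RatCells.ratFns (Ioo a b)`).

References: M. Kontsevich, D. Zagier, *Periods* (2001), §1.2 rule (2).
-/

noncomputable section

open scoped BigOperators Polynomial
open Set MeasureTheory MvPolynomial
open Literature.NumberTheory.Transcendental Literature.NumberTheory.Transcendental.CurvePeriods
open Summit.KontsevichZagierPeriods.SymplecticScissors.RealOnePeriodRelationsNegative (M₁ H₁)

namespace Summit.KontsevichZagierPeriods.SymplecticScissors.RealOnePeriodRelations.ConicLayer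

/-- The generators of the algebraic-rational layer lie in `RatCells.cellSpanRat`: a literal rational
representation by the rational layer (`RatCells.of_mem_cellSpanRat`), an algebraic cell on `(a, b)`
by the affine rule-2 move `x = a + (b − a)t` onto `(0, 1)` (`RatCells.of_mem_cellSpanRat_Ioo`).
[cite: KontsevichZagier2001, §1.2 (rule 2)] -/
theorem of_mem_cellSpanRat_of_generator (r : KZ.IntegralRep 1)
    (hr : r.IsRational ∨
      (∃ a b : ℝ, IsAlgebraic ℚ a ∧ IsAlgebraic ℚ b ∧ a < b ∧ r.domain = {z | z 0 ∈ Set.Ioo a b} ∧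
        ∃ P Q : Polynomial (algebraicClosure ℚ ℝ), (∀ x ∈ Set.Ioo a b, Polynomial.aeval x Q ≠ 0) ∧
          ∀ x ∈ Set.Ioo a b, r.integrand (fun _ => x) = Polynomial.aeval x P / Polynomial.aeval x Q)) :
    KZ.of r ∈ RatCells.cellSpanRat := by
  rcases hr with hr | ⟨a, b, ha, hb, hab, hdom, P, Q, hQ, hPQ⟩
  · exact RatCells.of_mem_cellSpanRat r (RatCells.ratFns_of_isRational r hr)
  · exact RatCells.of_mem_cellSpanRat_Ioo r hab ha hb hdom ⟨P, Q, hQ, hPQ⟩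

/-- **Stub `stub_algRatCells`** (line `nash-retraction-thin-strip`, reshape 9) — CELLS OF THE
ALGEBRAIC-RATIONAL LAYER.  Every `c` in the subgroup generated by Kontsevich–Zagier's literal rational
representations and by representations on intervals `(a, b)` with real algebraic end points whose
integrand is a quotient `P/Q` of polynomials with real algebraic coefficients (`Q ≠ 0` on `(a, b)`) is,
modulo `M₁`, a `ℤ`-combination of unit cells of the same shape on `(0, 1)`: the generators lie in the
subgroup `RatCells.cellSpanRat` of such combinations (`of_mem_cellSpanRat_of_generator`: the affine
rule-2 move `x = a + (b − a)t`, algebraic coefficients staying algebraic, and the landed rational layer),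
hence so does their closure (`AddSubgroup.closure_le`). [cite: KontsevichZagier2001, §1.2 (rule 2)] -/
theorem stub_algRatCells : ∀ c : KZ.FormalRep,
    c ∈ AddSubgroup.closure ((fun r : KZ.IntegralRep 1 => KZ.of r) ''
      {r | r.IsRational ∨
        (∃ a b : ℝ, IsAlgebraic ℚ a ∧ IsAlgebraic ℚ b ∧ a < b ∧ r.domain = {z | z 0 ∈ Set.Ioo a b} ∧
          ∃ P Q : Polynomial (algebraicClosure ℚ ℝ), (∀ x ∈ Set.Ioo a b, Polynomial.aeval x Q ≠ 0) ∧
            ∀ x ∈ Set.Ioo a b, r.integrand (fun _ => x) = Polynomial.aeval x P / Polynomial.aeval x Q)}) →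
    ∃ N : KZ.IntegralRep 1 →₀ ℤ,
      (∀ ρ ∈ N.support, ρ.domain = {z | z 0 ∈ Set.Ioo (0 : ℝ) 1} ∧
        ∃ P Q : Polynomial (algebraicClosure ℚ ℝ),
          (∀ t ∈ Set.Ioo (0 : ℝ) 1, Polynomial.aeval t Q ≠ 0) ∧
          ∀ t ∈ Set.Ioo (0 : ℝ) 1, ρ.integrand (fun _ => t) = Polynomial.aeval t P / Polynomial.aeval t Q) ∧
      c - N.sum (fun ρ m => m • KZ.of ρ) ∈ M₁ := by
  intro c hc
  have h : AddSubgroup.closure ((fun r : KZ.IntegralRep 1 => KZ.of r) ''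
      {r | r.IsRational ∨
        (∃ a b : ℝ, IsAlgebraic ℚ a ∧ IsAlgebraic ℚ b ∧ a < b ∧ r.domain = {z | z 0 ∈ Set.Ioo a b} ∧
          ∃ P Q : Polynomial (algebraicClosure ℚ ℝ), (∀ x ∈ Set.Ioo a b, Polynomial.aeval x Q ≠ 0) ∧
            ∀ x ∈ Set.Ioo a b, r.integrand (fun _ => x) =
              Polynomial.aeval x P / Polynomial.aeval x Q)}) ≤ RatCells.cellSpanRat :=
    (AddSubgroup.closure_le _).mpr (by
      rintro _ ⟨r, hr, rfl⟩
      exact of_mem_cellSpanRat_of_generator r hr)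
  obtain ⟨N, hN, hcN⟩ := h hc
  exact ⟨N, hN, hcN⟩

end Summit.KontsevichZagierPeriods.SymplecticScissors.RealOnePeriodRelations.ConicLayer

end
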